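import Literature.NumberTheory.EllipticCurves.KummerSelmerStructure
import Literature.NumberTheory.GaloisRepresentations.ContinuousCohomologyConnecting
import HarnessLib

/-!
# The Kummer sequences of `E` as short exact sequences of discrete Galois modules, and the obstruction classes `δ`

Topic `NumberTheory/EllipticCurves`; namespace `WeierstrassCurve` (generic lemmas in
`Literature.NumberTheory.GaloisRepresentations`). Definitions with bodies and theorems only: **no
named fact is introduced** (D-0026).

The tree's continuous-cohomology library has the connecting homomorphisms
`δ₀ : M₃^Γ → H¹(Γ, M₁)`, `δ₁ : H¹(Γ, M₃) → H²(Γ, M₁)` of a short exact sequence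
`0 → M₁ → M₂ → M₃ → 0` of discrete modules (`IsSES`, `IsSES.δ₁`, with the exactness statements
`exists_map_one_eq_of_δ₁_eq_zero`, `δ₁_map_one`, …; file
`GaloisRepresentations/ContinuousCohomologyConnecting`). This file instantiates it for the two
Kummer sequences of a Weierstrass curve `E = W` over a field `F` of characteristic `0`
(discrete `Γ_F`-modules `W.galoisModule = E(F̄)`, `W.torsionGaloisModule n = E[n]` of
`GeomPointsGaloisModule.lean`):

* `kummer_isSES W hn` — **`0 → E[n] → E(F̄) →ⁿ E(F̄) → 0` is short exact** (`n ≠ 0`; surjectivity =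
  divisibility of `E(F̄)`, tree `zsmul_geomPoints_surjective_of_charZero`), with the morphisms
  `torsionInclGaloisModuleHom`, `zsmulGaloisModuleHom`; `cohomologyMap_zsmulGaloisModuleHom_one`:
  `H¹([n]) = n`;
* `kummerConnectingHom W hn : H¹(F, E) →+ H²(F, E[n])` — the Kummer obstruction `δ`, with
  **`δ a = 0 ↔ a ∈ n · H¹(F, E)`** (`kummerConnectingHom_eq_zero_iff`, `ker_kummerConnectingHom`;
  Milne, *ADT*, I, Lemma 6.16: "maps to zero in `H²(G_S, A_m)` iff its image in `H¹(G_S, A)` is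
  divisible by `m`");
* `torsion_isSES W hk d` — **`0 → E[k] → E[kd] →ᵏ E[d] → 0` is short exact** (the diagram
  `0 → A_m → A_{m²} →ᵐ A_m → 0` of Milne's construction, `k = d = m`), with
  `torsionConnectingHom W hk d : H¹(F, E[d]) →+ H²(F, E[k])`, the **lifting criterion**
  `δ b = 0 ↔ ∃ b₁ ∈ H¹(F, E[kd]), k_* b₁ = b` (`torsionConnectingHom_eq_zero_iff`) and the
  **agreement of the two obstructions** `δ (ι_* b) = δ b` (`kummerConnectingHom_torsionH1ToH1`,
  naturality of `δ₁` for the morphism from the finite to the Kummer sequence);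
* **local triviality**: if `res_E b` satisfies the local Kummer condition
  (`kummerLocalConditionAt W d E` of `KummerSelmerStructure.lean`) then `res_E (δ b) = 0`
  (`res_torsionConnectingHom_eq_zero_of_mem`, via the restricted sequence `IsSES.restrictField`,
  the naturality `IsSES.res_field_δ₁`, and the lift of local Kummer classes along `k`,
  `exists_map_torsionMulBy_localKummerClass_eq`); over a number field, **the obstruction of a Selmer
  class localises to `0` at every place** (`localization_torsionConnectingHom_eq_zero`,
  `localization_kummerConnectingHom_eq_zero`) — Milne's `Ш(K, A) → Ш²(K, A_m)` of Lemma 6.16, the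
  class deciding between the "first case" (`a ∈ m H¹(K, A)`, equivalently `b` lifts to
  `H¹(K, A_{m²})`) and the general case of the definition of the Cassels–Tate pairing
  (proof of Prop. 6.9).

Motivation: provefact `WeierstrassCurve.exists_casselsTate_pairing` (Silverman *AEC* X.4.14 =
Milne *ADT* I.6.13(a) for elliptic curves), whose proof (Lemmas 6.16, 6.17 and the final diagram
of I §6) runs through exactly these maps.

## References

* [MilneADT2006] J. S. Milne, *Arithmetic Duality Theorems*, 2nd ed. (2006), Ch. I §6: proof of
  Prop. 6.9 (pp. 78–79), Lemma 6.16 (p. 87).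
* [SilvermanAEC2009] J. H. Silverman, *The Arithmetic of Elliptic Curves*, 2nd ed. (2009), §VIII.2
  (the Kummer sequence), §X.4.
* [SerreGaloisCohomology1997] J.-P. Serre, *Galois Cohomology* (1997), I §2.2–2.4 (connecting maps,
  functoriality).
-/

noncomputable section

open scoped Classical

universe u

namespace Literature.NumberTheory.GaloisRepresentations

/-! ## Generic: morphisms of discrete Galois modules, restriction of short exact sequences to `Γ_E` -/

open CategoryTheory Field
open scoped ContRepresentation

section Generic

variable {K : Type u} [Field K]
variable {M₁ : Type u} [AddCommGroup M₁] [TopologicalSpace M₁] [DiscreteTopology M₁]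
variable {M₂ : Type u} [AddCommGroup M₂] [TopologicalSpace M₂] [DiscreteTopology M₂]
variable {M₃ : Type u} [AddCommGroup M₃] [TopologicalSpace M₃] [DiscreteTopology M₃]
variable {ρ₁ : DiscreteGaloisModule K M₁} {ρ₂ : DiscreteGaloisModule K M₂}
  {ρ₃ : DiscreteGaloisModule K M₃}

/-- The `TopRep` morphism of a morphism of discrete Galois modules (a continuous intertwining map of
the underlying `ContRepresentation`s), as used inside `galoisCohomology.map`. [folklore] -/
abbrev DiscreteGaloisModule.homOfIntertwining
    (f : ρ₁.toContRepresentation →ⁱL ρ₂.toContRepresentation) : ρ₁.toTopRep ⟶ ρ₂.toTopRep :=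
  TopRep.ofHom ⟨f.toContinuousLinearMap, f.isIntertwining'⟩

/-- `cohomologyMap (homOfIntertwining f) n = galoisCohomology.map f n`. [folklore] -/
theorem DiscreteGaloisModule.cohomologyMap_homOfIntertwining
    (f : ρ₁.toContRepresentation →ⁱL ρ₂.toContRepresentation) (n : ℕ) (x : galoisCohomology ρ₁ n) :
    cohomologyMap (DiscreteGaloisModule.homOfIntertwining f) n x = galoisCohomology.map f n x :=
  rfl

variable (E : Type u) [Field E] [Algebra K E]

/-- Restriction to `Γ_E` (along `absGaloisRestrict K E`) of a morphism of discrete `Γ_K`-modules: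
the same map between the restricted modules `GaloisRep.restrictField E ρᵢ`. [folklore] -/
def DiscreteGaloisModule.resFieldHom (f : ρ₁.toTopRep ⟶ ρ₂.toTopRep) :
    DiscreteGaloisModule.toTopRep (GaloisRep.restrictField E ρ₁) ⟶
      DiscreteGaloisModule.toTopRep (GaloisRep.restrictField E ρ₂) :=
  TopRep.ofHom ⟨f.hom.toContinuousLinearMap, fun σ => f.hom.isIntertwining' (absGaloisRestrict K E σ)⟩

/-- Unfolding `resFieldHom`: the underlying map is that of `f`. [folklore] -/
@[simp]
theorem DiscreteGaloisModule.resFieldHom_apply (f : ρ₁.toTopRep ⟶ ρ₂.toTopRep) (x : M₁) :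
    (DiscreteGaloisModule.resFieldHom E f).hom x = f.hom x :=
  rfl

/-- **A short exact sequence of discrete `Γ_K`-modules restricts to one of `Γ_E`-modules** (same
maps; cf. the tree's `IsSES.res` for subgroups). [folklore] -/
theorem IsSES.restrictField {f : ρ₁.toTopRep ⟶ ρ₂.toTopRep} {g : ρ₂.toTopRep ⟶ ρ₃.toTopRep}
    (h : IsSES f g) :
    IsSES (DiscreteGaloisModule.resFieldHom E f) (DiscreteGaloisModule.resFieldHom E g) :=
  ⟨by
    ext x
    exact h.g_f_apply x, h.injective, h.exact_mid, h.surjective⟩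

-- `δ₁` and `twoCocycleClass` need `LocallyCompactSpace Γ`.
attribute [local instance] absoluteGaloisGroup_compactSpace

/-- **Naturality of `δ₁` under restriction to `Γ_E`**: `res_E (δ₁ x) = δ₁ (res_E x)` for the
restricted short exact sequence (on cocycles: the restriction of a lift is a lift of the
restriction, and `f⁻¹` is unchanged; cf. the tree's `IsSES.res_δ₁` for subgroups).
[cite: SerreGaloisCohomology1997, I §2.4] -/
theorem IsSES.res_field_δ₁ {f : ρ₁.toTopRep ⟶ ρ₂.toTopRep} {g : ρ₂.toTopRep ⟶ ρ₃.toTopRep}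
    (h : IsSES f g) (x : galoisCohomology ρ₃ 1) :
    galoisCohomology.res ρ₁ E 2 (h.δ₁ x) =
      (h.restrictField E).δ₁ (galoisCohomology.res ρ₃ E 1 x) := by
  obtain ⟨φ, rfl⟩ := oneCocycleClass_surjective ρ₃.toTopRep x
  rw [IsSES.δ₁_oneCocycleClass_eq_δ₁Aux, IsSES.δ₁Aux]
  refine (map_twoCocycleClass (absGaloisRestrict K E) (X := ρ₁.toTopRep)
    (Y := DiscreteGaloisModule.toTopRep (GaloisRep.restrictField E ρ₁)) (𝟙 _) _).trans ?_
  refine Eq.trans ?_ (congrArg (h.restrictField E).δ₁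
    (galoisCohomology.res_one_oneCocycleClass E φ)).symm
  -- the restricted lift
  let φt : C(absoluteGaloisGroup E, M₂) :=
    (h.liftCocycle φ).comp (absGaloisRestrict K E : C(absoluteGaloisGroup E, absoluteGaloisGroup K))
  have hφt : ∀ σ τ : absoluteGaloisGroup E, (DiscreteGaloisModule.resFieldHom E g).hom (φt (σ * τ)) =
      (DiscreteGaloisModule.resFieldHom E g).hom (φt σ) +
        (GaloisRep.restrictField E ρ₃) σ ((DiscreteGaloisModule.resFieldHom E g).hom (φt τ)) :=
    fun σ τ => by
      change g.hom (h.liftCocycle φ (absGaloisRestrict K E (σ * τ))) = g.hom (h.liftCocycle φ _) +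
        ρ₃ (absGaloisRestrict K E σ) (g.hom (h.liftCocycle φ _))
      rw [_root_.map_mul]
      exact h.liftCocycle_isLift φ _ _
  have e : contOneCocycles.pullback (absGaloisRestrict K E) (X := ρ₃.toTopRep)
      (Y := DiscreteGaloisModule.toTopRep (GaloisRep.restrictField E ρ₃))
      (TopRep.ofHom ⟨ContinuousLinearMap.id ℤ M₃, fun _ => rfl⟩) φ = IsSES.pushCocycle φt hφt :=
    Subtype.ext (ContinuousMap.ext fun σ => (h.g_liftCocycle_apply φ _).symm)
  rw [e, IsSES.δ₁_oneCocycleClass]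
  refine congrArg _ (Subtype.ext (ContinuousMap.ext fun q => ?_))
  obtain ⟨σ, τ⟩ := q
  apply (h.restrictField E).injective
  rw [(h.restrictField E).f_connectingCocycle_apply]
  change f.hom ((h.connectingCocycle (h.liftCocycle φ) (h.liftCocycle_isLift φ)).1
      (absGaloisRestrict K E σ, absGaloisRestrict K E τ)) =
    ρ₂ (absGaloisRestrict K E σ) (h.liftCocycle φ (absGaloisRestrict K E τ)) -
      h.liftCocycle φ (absGaloisRestrict K E (σ * τ)) + h.liftCocycle φ (absGaloisRestrict K E σ)
  rw [_root_.map_mul]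
  exact h.f_connectingCocycle_apply _ _ _ _

end Generic

end Literature.NumberTheory.GaloisRepresentations

namespace WeierstrassCurve

open CategoryTheory Literature.NumberTheory.EllipticCurves Literature.NumberTheory.GaloisRepresentations
  Field
open scoped ContRepresentation

-- `δ₁` and `twoCocycleClass` need `LocallyCompactSpace Γ_F`; as in the tree's cup-product files,
-- the compactness of absolute Galois groups is a local instance only.
attribute [local instance] absoluteGaloisGroup_compactSpace

variable {F : Type u} [Field F] (W : WeierstrassCurve F)

/-! ## The Kummer sequence `0 → E[n] → E(F̄) →ⁿ E(F̄) → 0` -/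

/-- The inclusion `E[n] ↪ E(F̄)` as a morphism of the attached topological representations
(`W.torsionGaloisModule n → W.galoisModule`). Silverman, *AEC*, VIII.§2. [folklore] -/
def torsionInclGaloisModuleHom (n : ℤ) :
    (W.torsionGaloisModule n).toTopRep ⟶ W.galoisModule.toTopRep :=
  TopRep.ofHom ⟨⟨(geomTorsion W n).subtype.toIntLinearMap, continuous_of_discreteTopology⟩,
    fun σ => by ext P; rfl⟩

/-- Unfolding `torsionInclGaloisModuleHom`: it is the coercion `E[n] → E(F̄)`. [folklore] -/
@[simp]
theorem torsionInclGaloisModuleHom_apply (n : ℤ) (P : geomTorsion W n) :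
    (W.torsionInclGaloisModuleHom n).hom P = (P : geomPoints W) :=
  rfl

/-- Multiplication by `n` on `E(F̄)` as an endomorphism of the attached topological representation
(equivariant: `σ (nP) = n (σP)`). Silverman, *AEC*, VIII.§2. [folklore] -/
def zsmulGaloisModuleHom (n : ℤ) : W.galoisModule.toTopRep ⟶ W.galoisModule.toTopRep :=
  TopRep.ofHom ⟨⟨(zsmulAddGroupHom (α := geomPoints W) n).toIntLinearMap,
      continuous_of_discreteTopology⟩,
    fun σ => by
      ext P
      exact (smul_zsmul_geomPoints W n σ P).symm⟩

/-- Unfolding `zsmulGaloisModuleHom`: `P ↦ n • P`. [folklore] -/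
@[simp]
theorem zsmulGaloisModuleHom_apply (n : ℤ) (P : geomPoints W) :
    (W.zsmulGaloisModuleHom n).hom P = n • P :=
  rfl

/-- **The Kummer sequence of `E` is short exact** over a field of characteristic `0` and for
`n ≠ 0`: `0 → E[n] → E(F̄) →ⁿ E(F̄) → 0` is a short exact sequence of discrete `Γ_F`-modules
(`IsSES`; surjectivity of `[n]` on `E(F̄)` is the tree's `zsmul_geomPoints_surjective_of_charZero`,
Silverman, *AEC*, §VIII.2 with Prop. III.4.2(a), Thm. II.2.3, and Prop. III.2.5 for singular cubics).
[cite: SilvermanAEC2009, §VIII.2 (the Kummer sequence for E/K)] -/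
theorem kummer_isSES [CharZero F] {n : ℤ} (hn : n ≠ 0) :
    IsSES (W.torsionInclGaloisModuleHom n) (W.zsmulGaloisModuleHom n) where
  comp_eq_zero := by
    ext P
    exact (mem_geomTorsion_iff W n _).mp P.2
  injective := Subtype.val_injective
  exact_mid := fun y hy => ⟨⟨y, (mem_geomTorsion_iff W n y).mpr hy⟩, rfl⟩
  surjective := W.zsmul_geomPoints_surjective_of_charZero hn

/-- **`H¹([n]) = n` on `H¹(F, E)`**: the map induced on `H¹(F, E) = W.galH1` by multiplication by
`n` on `E(F̄)` is multiplication by `n` (on crossed homomorphisms, `[n] ∘ φ = n • φ`). [folklore] -/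
theorem cohomologyMap_zsmulGaloisModuleHom_one (n : ℤ) (y : W.galH1) :
    cohomologyMap (W.zsmulGaloisModuleHom n) 1 y = n • y := by
  obtain ⟨φ, rfl⟩ := oneCocycleClass_surjective W.galoisModule.toTopRep y
  rw [cohomologyMap_oneCocycleClass]
  have h1 : contOneCocycles.pullback (ContinuousMonoidHom.id _)
      (resIdHom (W.zsmulGaloisModuleHom n)) φ = n • φ :=
    Subtype.ext (ContinuousMap.ext fun σ => rfl)
  rw [h1]
  exact (oneCocycleClass_smul (X := W.galoisModule.toTopRep) n φ).trans
    (Int.cast_smul_eq_zsmul ℤ n _)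

section Kummer

variable [CharZero F] {n : ℤ} (hn : n ≠ 0)

/-- **The Kummer connecting homomorphism `δ : H¹(F, E) → H²(F, E[n])`** of the Kummer sequence
`0 → E[n] → E →ⁿ E → 0` (`IsSES.δ₁` of `kummer_isSES`): the obstruction to dividing a class of
`H¹(F, E)` by `n`. Milne, *ADT*, I §6, proof of Lemma 6.16 (the map `H¹(G_S, A) → H²(G_S, A_m)`).
[cite: MilneADT2006, Ch. I §6, Lemma 6.16] -/
def kummerConnectingHom : W.galH1 →+ galoisCohomology (W.torsionGaloisModule n) 2 :=
  (W.kummer_isSES hn).δ₁.toAddMonoidHom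

/-- Unfolding `kummerConnectingHom`. [folklore] -/
theorem kummerConnectingHom_apply (a : W.galH1) :
    W.kummerConnectingHom hn a = (W.kummer_isSES hn).δ₁ a :=
  rfl

/-- **`δ(n a₁) = 0`**: multiples of `n` have no obstruction. [cite: MilneADT2006, Ch. I §6, Lemma 6.16] -/
theorem kummerConnectingHom_zsmul (a₁ : W.galH1) : W.kummerConnectingHom hn (n • a₁) = 0 := by
  rw [kummerConnectingHom_apply, ← cohomologyMap_zsmulGaloisModuleHom_one]
  exact (W.kummer_isSES hn).δ₁_map_one a₁

/-- **Exactness of `H¹(F, E) →ⁿ H¹(F, E) →δ H²(F, E[n])`** (Milne, *ADT*, I, proof of Lemma 6.16: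
"an element … maps to zero in `H²(G_S, A_m)` if and only if its image in `H¹(G_S, A)` is divisible
by `m`"): `δ a = 0 ↔ a ∈ n · H¹(F, E)`. [cite: MilneADT2006, Ch. I §6, Lemma 6.16] -/
theorem kummerConnectingHom_eq_zero_iff (a : W.galH1) :
    W.kummerConnectingHom hn a = 0 ↔ ∃ a₁ : W.galH1, n • a₁ = a := by
  constructor
  · intro ha
    obtain ⟨y, hy⟩ := (W.kummer_isSES hn).exists_map_one_eq_of_δ₁_eq_zero a ha
    exact ⟨y, (W.cohomologyMap_zsmulGaloisModuleHom_one n y).symm.trans hy⟩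
  · rintro ⟨a₁, rfl⟩
    exact W.kummerConnectingHom_zsmul hn a₁

/-- The same in terms of the range of multiplication by `n`:
`ker δ = n · H¹(F, E)`. [cite: MilneADT2006, Ch. I §6, Lemma 6.16] -/
theorem ker_kummerConnectingHom :
    (W.kummerConnectingHom hn).ker = (zsmulAddGroupHom (α := W.galH1) n).range := by
  ext a
  rw [AddMonoidHom.mem_ker, kummerConnectingHom_eq_zero_iff, AddMonoidHom.mem_range]
  rfl

omit [CharZero F] in
/-- The map induced on `H¹` by `torsionInclGaloisModuleHom` is the tree's
`torsionH1ToH1 : H¹(F, E[n]) → H¹(F, E)` (whose image is the `n`-torsion, `range_torsionH1ToH1`).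
[folklore] -/
theorem cohomologyMap_torsionInclGaloisModuleHom_one (c : galH1Torsion W n) :
    cohomologyMap (W.torsionInclGaloisModuleHom n) 1 c = torsionH1ToH1 W n c :=
  rfl

/-- **`H²(ι) ∘ δ = 0`** for the Kummer sequence: the obstruction class dies in `H²(F, E)`.
[folklore] -/
theorem cohomologyMap_two_kummerConnectingHom (a : W.galH1) :
    cohomologyMap (W.torsionInclGaloisModuleHom n) 2 (W.kummerConnectingHom hn a) = 0 :=
  (W.kummer_isSES hn).map_two_δ₁ a

/-- **Milne's Lemma 6.16 for `E`, divisible case**: if `a` is divisible by `n` in `H¹(F, E)` then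
its Kummer obstruction vanishes (and conversely, `kummerConnectingHom_eq_zero_iff`): the subgroup
`Ш₀ = {a ∈ Ш : a ∈ n H¹(K, E)}` is the kernel of `Ш → Ш²(K, E[n])`.
[cite: MilneADT2006, Ch. I §6, Lemma 6.16] -/
theorem kummerConnectingHom_eq_zero_of_zsmul_eq {a a₁ : W.galH1} (h : n • a₁ = a) :
    W.kummerConnectingHom hn a = 0 :=
  (W.kummerConnectingHom_eq_zero_iff hn a).mpr ⟨a₁, h⟩

end Kummer

/-! ## The finite Kummer sequences `0 → E[k] → E[kd] →ᵏ E[d] → 0` -/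

section Finite

variable [CharZero F]

/-- **The finite Kummer sequence `0 → E[k] → E[kd] →ᵏ E[d] → 0` is short exact** (`k, d ≠ 0`,
characteristic `0`): the inclusion `torsionInclusion` and the multiplication `torsionMulBy k d`
(`P ↦ kP`); surjectivity by the divisibility of `E(F̄)`. Milne, *ADT*, I §6, proof of Prop. 6.9 (the
diagram `0 → A_m → A_{m²} →ᵐ A_m → 0`, case `k = d = m`; no hypothesis on `d`).
[cite: MilneADT2006, Ch. I §6, proof of Prop. 6.9] -/
theorem torsion_isSES {k : ℤ} (hk : k ≠ 0) (d : ℤ) :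
    IsSES (DiscreteGaloisModule.homOfIntertwining (W.torsionInclusion (Dvd.intro d rfl : k ∣ k * d)))
      (DiscreteGaloisModule.homOfIntertwining (W.torsionMulBy k d)) where
  comp_eq_zero := by
    ext P
    exact (mem_geomTorsion_iff W k _).mp P.2
  injective := fun P Q h => Subtype.ext (congrArg Subtype.val h :)
  exact_mid := fun P hP => by
    have hP' : k • (P : geomPoints W) = 0 := congrArg Subtype.val hP
    exact ⟨⟨P, (mem_geomTorsion_iff W k _).mpr hP'⟩, rfl⟩
  surjective := fun Q => by
    obtain ⟨P, hP⟩ := W.zsmul_geomPoints_surjective_of_charZero hk (Q : geomPoints W)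
    have hP' : k • P = (Q : geomPoints W) := hP
    have hPmem : P ∈ geomTorsion W (k * d) := by
      rw [mem_geomTorsion_iff, mul_comm, mul_zsmul, hP']
      exact (mem_geomTorsion_iff W d _).mp Q.2
    exact ⟨⟨P, hPmem⟩, Subtype.ext hP'⟩

variable {k : ℤ} (hk : k ≠ 0) (d : ℤ)

/-- **The finite Kummer connecting homomorphism `δ : H¹(F, E[d]) → H²(F, E[k])`** of
`0 → E[k] → E[kd] →ᵏ E[d] → 0`: the obstruction to lifting a class of `H¹(F, E[d])` to
`H¹(F, E[kd])` along multiplication by `k` — in the construction of the Cassels–Tate pairing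
(`k = d = m`) the obstruction to lifting `b ∈ H¹(K, E[m])` to `b₁ ∈ H¹(K, E[m²])`
(Milne, *ADT*, I, proof of Prop. 6.9, "from this diagram … in general … will be nonzero").
[cite: MilneADT2006, Ch. I §6, proof of Prop. 6.9] -/
def torsionConnectingHom :
    galoisCohomology (W.torsionGaloisModule d) 1 →+ galoisCohomology (W.torsionGaloisModule k) 2 :=
  (W.torsion_isSES hk d).δ₁.toAddMonoidHom

/-- Unfolding `torsionConnectingHom`. [folklore] -/
theorem torsionConnectingHom_apply (b : galoisCohomology (W.torsionGaloisModule d) 1) :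
    W.torsionConnectingHom hk d b = (W.torsion_isSES hk d).δ₁ b :=
  rfl

/-- **Lifting criterion**: `b ∈ H¹(F, E[d])` lifts to `H¹(F, E[kd])` along multiplication by `k`
iff its finite Kummer obstruction vanishes: `δ b = 0 ↔ ∃ b₁, k_* b₁ = b`.
[cite: MilneADT2006, Ch. I §6, proof of Prop. 6.9] -/
theorem torsionConnectingHom_eq_zero_iff (b : galoisCohomology (W.torsionGaloisModule d) 1) :
    W.torsionConnectingHom hk d b = 0 ↔
      ∃ b₁ : galoisCohomology (W.torsionGaloisModule (k * d)) 1,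
        galoisCohomology.map (W.torsionMulBy k d) 1 b₁ = b := by
  constructor
  · intro hb
    obtain ⟨y, hy⟩ := (W.torsion_isSES hk d).exists_map_one_eq_of_δ₁_eq_zero b hb
    exact ⟨y, hy⟩
  · rintro ⟨b₁, rfl⟩
    exact (W.torsion_isSES hk d).δ₁_map_one b₁

/-- **The two obstructions agree**: for `b ∈ H¹(F, E[d])` with image `a = ι_* b ∈ H¹(F, E)`, the
Kummer obstruction `δ a ∈ H²(F, E[k])` to dividing `a` by `k` equals the finite obstruction `δ b`
to lifting `b` to `H¹(F, E[kd])` (naturality of `δ₁` for the morphism of short exact sequences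
`(id, E[kd] ↪ E, E[d] ↪ E)` from the finite to the Kummer sequence). Milne, *ADT*, I, proof of
Prop. 6.9 (the two descriptions of the first case: `a ∈ m H¹` / `b` lifts to `H¹(A_{m²})`, modulo
`H¹(A_m)`) and Lemma 6.16. [cite: MilneADT2006, Ch. I §6, proof of Prop. 6.9 and Lemma 6.16] -/
theorem kummerConnectingHom_torsionH1ToH1 (b : galoisCohomology (W.torsionGaloisModule d) 1) :
    W.kummerConnectingHom hk (torsionH1ToH1 W d b) = W.torsionConnectingHom hk d b := by
  obtain ⟨φ, rfl⟩ := oneCocycleClass_surjective (W.torsionGaloisModule d).toTopRep b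
  set h := W.torsion_isSES hk d
  set hK := W.kummer_isSES (n := k) hk
  -- the lift `φ̃ : Γ → E[kd]` of `φ`, and `ι ∘ φ̃ : Γ → E(F̄)`, a lift of `ι ∘ φ` for the Kummer sequence
  let ψt : C(absoluteGaloisGroup F, geomPoints W) :=
    (⟨(geomTorsion W (k * d)).subtype, continuous_of_discreteTopology⟩ :
      C(geomTorsion W (k * d), geomPoints W)).comp (h.liftCocycle φ)
  have hψt : ∀ σ τ, (W.zsmulGaloisModuleHom k).hom (ψt (σ * τ)) =
      (W.zsmulGaloisModuleHom k).hom (ψt σ) + W.galoisModule σ ((W.zsmulGaloisModuleHom k).hom (ψt τ)) :=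
    fun σ τ => by
      have e := congrArg (Subtype.val : geomTorsion W d → geomPoints W) (h.liftCocycle_isLift φ σ τ)
      exact e
  have e1 : torsionH1ToH1 W d (oneCocycleClass (W.torsionGaloisModule d).toTopRep φ) =
      oneCocycleClass W.galoisModule.toTopRep (IsSES.pushCocycle ψt hψt) := by
    rw [← cohomologyMap_torsionInclGaloisModuleHom_one, cohomologyMap_oneCocycleClass]
    refine congrArg _ (Subtype.ext (ContinuousMap.ext fun σ => ?_))
    exact (congrArg (Subtype.val : geomTorsion W d → geomPoints W) (h.g_liftCocycle_apply φ σ)).symm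
  rw [kummerConnectingHom_apply, e1, hK.δ₁_oneCocycleClass, torsionConnectingHom_apply,
    ← h.pushCocycle_liftCocycle φ, h.δ₁_oneCocycleClass]
  refine congrArg _ (Subtype.ext (ContinuousMap.ext fun q => ?_))
  obtain ⟨σ, τ⟩ := q
  apply hK.injective
  rw [hK.f_connectingCocycle_apply]
  change _ = ((h.connectingCocycle (h.liftCocycle φ) (h.liftCocycle_isLift φ)).1 (σ, τ) : geomPoints W)
  have e2 := congrArg (Subtype.val : geomTorsion W (k * d) → geomPoints W)
    (h.f_connectingCocycle_apply (h.liftCocycle φ) (h.liftCocycle_isLift φ) σ τ)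
  exact e2.symm ▸ rfl

/-! ### Classes satisfying the local Kummer condition have locally trivial obstruction -/

variable {E : Type u} [Field E] [Algebra F E] [W.IsElliptic]

/-- **The finite obstruction of a class with the local Kummer condition at `E` dies over `E`**:
if `res_E b ∈ 𝓛_E = ker (H¹(E, E[d]) → H¹(E, E(F̄_E)))` (`kummerLocalConditionAt`), then
`res_E (δ b) = 0` in `H²(E, E[k])` — because `res_E b` is a local Kummer class `κ(Q)`, which lifts
along `k` to the local Kummer class of a `k`-th root `Q₁` of `Q` (tree:
`exists_map_torsionMulBy_localKummerClass_eq`), and `δ ∘ k_* = 0`. This is the local half of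
Milne's "`b_v` lifts to `b_{v,1} ∈ H¹(K_v, A_{m²})`" (*ADT* I, proof of Prop. 6.9); for a number
field and `E = K_v` it says that the obstruction `δ b` of a Selmer class lies in `Ш²(K, E[k])`.
[cite: MilneADT2006, Ch. I §6, proof of Prop. 6.9] -/
theorem res_torsionConnectingHom_eq_zero_of_mem (hd : d ≠ 0)
    (b : galoisCohomology (W.torsionGaloisModule d) 1)
    (hb : galoisCohomology.res (W.torsionGaloisModule d) E 1 b ∈ W.kummerLocalConditionAt d E) :
    galoisCohomology.res (W.torsionGaloisModule k) E 2 (W.torsionConnectingHom hk d b) = 0 := by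
  rw [torsionConnectingHom_apply, (W.torsion_isSES hk d).res_field_δ₁ E]
  obtain ⟨Q, hQ, hc⟩ := W.exists_eq_localKummerClass_of_mem d hd hb
  obtain ⟨Q₁, hQ₁, -, h1⟩ :=
    W.exists_map_torsionMulBy_localKummerClass_eq k d (mul_ne_zero hk hd) hd Q hQ
  rw [hc, ← h1]
  exact ((W.torsion_isSES hk d).restrictField E).δ₁_map_one _

/-- The same for the Kummer obstruction of `a = ι_* b ∈ H¹(F, E)`: if `res_E b ∈ 𝓛_E` then
`res_E (δ a) = 0` in `H²(E, E[k])`. [cite: MilneADT2006, Ch. I §6, proof of Prop. 6.9 and Lemma 6.16] -/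
theorem res_kummerConnectingHom_torsionH1ToH1_eq_zero_of_mem (hd : d ≠ 0)
    (b : galoisCohomology (W.torsionGaloisModule d) 1)
    (hb : galoisCohomology.res (W.torsionGaloisModule d) E 1 b ∈ W.kummerLocalConditionAt d E) :
    galoisCohomology.res (W.torsionGaloisModule k) E 2
      (W.kummerConnectingHom hk (torsionH1ToH1 W d b)) = 0 := by
  rw [kummerConnectingHom_torsionH1ToH1]
  exact W.res_torsionConnectingHom_eq_zero_of_mem hk d hd b hb

end Finite

/-! ## Over a number field: the obstruction of a Selmer class is locally trivial everywhere -/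

section NumberField

open NumberField

variable [NumberField F] [W.IsElliptic] {k : ℤ} (hk : k ≠ 0) {d : ℤ}

/-- **The obstruction of a Selmer class lies in `Ш²`**: for `b` in the `d`-Selmer group
`selmerGroup W d` (= the Selmer group of the Kummer Selmer structure of `E[d]`, tree
`selmerGroup_eq_selmerGroup_kummerSelmerStructure`), the finite obstruction
`δ b ∈ H²(K, E[k])` localises to `0` at every place `v`. Milne, *ADT*, I, proof of Prop. 6.9 and
Lemma 6.16 (`Ш(K, A) → Ш²_S(K, A_m)`). [cite: MilneADT2006, Ch. I §6, Lemma 6.16] -/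
theorem localization_torsionConnectingHom_eq_zero (hd : d ≠ 0)
    {b : galoisCohomology (W.torsionGaloisModule d) 1}
    (hb : b ∈ selmerGroup W d) (v : Place F) :
    galoisCohomology.localization (W.torsionGaloisModule k) v 2 (W.torsionConnectingHom hk d b) = 0 :=
  W.res_torsionConnectingHom_eq_zero_of_mem hk d hd b
    ((W.mem_selmerGroup_iff_forall_localization_mem d b).mp hb v)

/-- The same for the Kummer obstruction `δ a ∈ H²(K, E[k])` of the image `a = ι_* b ∈ H¹(K, E)` of a
Selmer class (so of any `a ∈ Ш(E/K)[d]`, by `exists_mem_selmerGroup_kummerSelmerStructure_of_mem_sha`):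
it localises to `0` everywhere. [cite: MilneADT2006, Ch. I §6, Lemma 6.16] -/
theorem localization_kummerConnectingHom_eq_zero (hd : d ≠ 0)
    {b : galoisCohomology (W.torsionGaloisModule d) 1}
    (hb : b ∈ selmerGroup W d) (v : Place F) :
    galoisCohomology.localization (W.torsionGaloisModule k) v 2
      (W.kummerConnectingHom hk (torsionH1ToH1 W d b)) = 0 := by
  rw [kummerConnectingHom_torsionH1ToH1]
  exact W.localization_torsionConnectingHom_eq_zero hk hd hb v

end NumberField

end WeierstrassCurve
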